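import Summits.BirchSwinnertonDyer.BirchSwinnertonDyer.Theorems.GenusKolyvaginAtTwoMinimalTwinBSDTwoKrizLiAnchor67a1
import Literature.NumberTheory.EllipticCurves.Curve11aAnalyticRankZero
import Literature.NumberTheory.EllipticCurves.BSDRootNumberModularityOnlyProofs
import HarnessLib

/-!
# Route `GenusKolyvaginAtTwo`, crux U₂ `MinimalTwinBSDTwo` (stmt-BirchSwinnertonDyer-22985), LINE 23 «twin_swap»: THE ROOT NUMBER OF THE RANK-ZERO ANCHOR `67a1`
# IS `+1` (split multiplicative reduction at the single bad prime `67`), HENCE `ord_{s=1} L(67a1, s) = 0` MODULO MODULARITY + Kriz–Li Thm 4.3 — the displayed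
# `r_an(67a1) = 0` of the road `…KrizLiAnchor67a1.lean` DISCHARGED: the rank-one half of the `67a1` packet is U₂-settled from PRINT + MODULARITY ALONE

Seat `bsd-line-gk2-p2` g35 (PROVER 2/3, cell `bsd-f1-sign2`; LINE 23 holder), `--supports stmt-BirchSwinnertonDyer-22985` (helper; closes nothing).
THEOREMS ONLY (0 `def`, 0 `sorry`); standard axioms.  HONEST FRAMING (D-0014/D-0036): the method and lemma names are those of the tree's
`Literature/…/Curve11aAnalyticRankZero.lean` (`11a`: split place at `11`) and `Curve37aRootNumber.lean` (`37a`: non-split), transplanted to Cremona's `67A1`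
(`⟨0, 1, 1, -12, -21⟩ `, `Δ = -67`, `c₄ = 592`, `N = 67`): at `v ∤ 67` the discriminant is a `v`-unit (good reduction, `W_v = +1`); at the place above `67`, `c₄ = 592` is a
unit (Bezout `6·592 − 53·67 = 1`) and `v(Δ) < 1`, so the reduction is multiplicative, and SPLIT: Mathlib's node-tangent quadratic
`c₄T² + a₁c₄T − (54b₆ − 3b₂b₄ + a₂c₄) = 592T² + 3602` factors as `592(T − 30)(T + 30)` over `κ(O_v) ⊇ 𝔽_67` (`592·30² + 3602 = 536402 = 67·8006`),
i.e. `a_67(67a1) = +1`, so `W_67 = −1` (Rohrlich) and the algebraic root number `−∏_v W_v = +1`; by the Modularity Theorem (`exists_isNewformOf`) and the tree's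
PROVED Atkin–Lehner comparison for squarefree conductor (`rootNumber_eq_algebraicRootNumber_of_squarefree`), `w(67a1) = +1`; parity (tree
`even_analyticRank_iff_rootNumber_eq_one_of_exists_isNewformOf`) makes `r_an` even, and Kriz–Li Thm 4.3 with the Table-2 (★)-datum (`krizLi_analyticRank_le_one`)
caps it at `1`: **`r_an(67a1) = 0`** — Cremona's Table 1 entry `r = 0` as a theorem modulo PRINT (§3).  §4 re-issues the U₂ sorting of `…KrizLiAnchor67a1.lean` with
`hmod` in place of the displayed `hr`: `printFamily67A1_krizLi_rankOneCompanions_of_modularity` etc.  **BSD is NOT proved by any of this; U₂ is NOT proved; no item is closed.**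

References: [CremonaAlgorithms1997] Table 1 (curve 67A1: `r = 0`), §2.11, Appendix to Ch. II; [SilvermanAEC2009] VII.5 Prop. 5.1, C.16 Thm. 16.3; [Rohrlich1993Compositio]
Prop. 2; [KrizLi2019] Thm 4.3, §6 Table 2 (row 67a1); [BCDTJAMS2001] Thm. A.
-/

set_option autoImplicit false
-- the Theorems namespace of this sub repeats the summit name by design (D-0017 nested layout)
set_option linter.dupNamespace false

noncomputable section

open scoped Classical

open IsDedekindDomain IsDedekindDomain.HeightOneSpectrum WeierstrassCurve Polynomial NumberField
  Literature.NumberTheory.EllipticCurves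
  Literature.NumberTheory.EllipticCurves.ModularForms
  Literature.NumberTheory.EllipticCurves.Rank1Residual
  Literature.NumberTheory.EllipticCurves.Rank1Residual.Typed
  Summit.BirchSwinnertonDyer.Rank1Residual
  Summit.BirchSwinnertonDyer.Rank1Residual.P2
  Summit.BirchSwinnertonDyer.BirchSwinnertonDyer.Theorems.AddPotGoodPrint
  Summit.BirchSwinnertonDyer.BirchSwinnertonDyer.Theorems.GenusExact.TwinSwap.KrizLiAnchorWall

namespace Summit.BirchSwinnertonDyer.BirchSwinnertonDyer.Theorems.GenusExact.TwinSwap.KrizLiAnchor67a1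

/-! ## §1 Invariants of the equation over `ℚ` -/
section Invariants67A1

/-- `Δ(67a1) = -67` (rational model). [cite: CremonaAlgorithms1997, Table 1 (67A1)] -/
theorem Δ_67A1 : (⟨0, 1, 1, -12, -21⟩ : WeierstrassCurve ℚ).Δ = -67 := by
  norm_num [WeierstrassCurve.Δ, WeierstrassCurve.b₂, WeierstrassCurve.b₄, WeierstrassCurve.b₆, WeierstrassCurve.b₈]

/-- `c₄(67a1) = 592` (rational model). [cite: CremonaAlgorithms1997, Table 1 (67A1)] -/
theorem c₄_67A1 : (⟨0, 1, 1, -12, -21⟩ : WeierstrassCurve ℚ).c₄ = 592 := by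
  norm_num [WeierstrassCurve.c₄, WeierstrassCurve.b₂, WeierstrassCurve.b₄]

/-- `67a1` is integral at every finite place of `ℤ`. [cite: SilvermanAEC2009, VIII.8] -/
theorem isIntegralAt_67A1 (v : HeightOneSpectrum ℤ) : (⟨0, 1, 1, -12, -21⟩ : WeierstrassCurve ℚ).IsIntegralAt v := by
  rw [isIntegralAt_iff_valuation_le_one]
  refine ⟨?_, ?_, ?_, ?_, ?_⟩
  · simp
  · simp
  · simp
  · simpa using v.valuation_le_one (K := ℚ) (-12 : ℤ)
  · simpa using v.valuation_le_one (K := ℚ) (-21 : ℤ)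

end Invariants67A1

/-! ## §2 Local root numbers: `+1` away from `67`, `−1` at the split place above `67`; algebraic root number `+1` -/
section LocalRootNumbers67A1

/-- At a place `v` with `v(Δ) = 1` (`v ∤ 67`) the curve has good reduction, so `W_v = 1`. [cite: Rohrlich1993Compositio, Prop. 2(i)] -/
theorem localRootNumberAt_of_valuation_Δ_eq_one_67A1 (v : HeightOneSpectrum ℤ)
    (h : v.valuation ℚ (⟨0, 1, 1, -12, -21⟩ : WeierstrassCurve ℚ).Δ = 1) :
    haveI := isElliptic_67A1
    (⟨0, 1, 1, -12, -21⟩ : WeierstrassCurve ℚ).localRootNumberAt v = 1 :=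
  haveI := isElliptic_67A1
  WeierstrassCurve.localRootNumberAt_of_hasGoodReductionAt
    (hasGoodReductionAt_of_valuation_Δ_eq_one_holds v _ (isIntegralAt_67A1 v) h)

/-- If `v(Δ) < 1` then `v` is the place above `67`: `67 ∈ v` (`Δ = −67`). [folklore] -/
theorem mem_of_valuation_Δ_lt_one_67A1 {v : HeightOneSpectrum ℤ}
    (h : v.valuation ℚ (⟨0, 1, 1, -12, -21⟩ : WeierstrassCurve ℚ).Δ < 1) : (67 : ℤ) ∈ v.asIdeal := by
  rw [Δ_67A1] at h
  have h' : v.valuation ℚ (algebraMap ℤ ℚ 67) ^ 1 < 1 := by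
    have : (-67 : ℚ) = -(algebraMap ℤ ℚ 67) ^ 1 := by norm_num
    rw [this, Valuation.map_neg, Valuation.map_pow] at h
    exact h
  have hlt : v.valuation ℚ (algebraMap ℤ ℚ 67) < 1 := by
    by_contra hle
    have h1 : v.valuation ℚ (algebraMap ℤ ℚ 67) = 1 :=
      le_antisymm (v.valuation_le_one (67 : ℤ)) (not_lt.mp hle)
    rw [h1, one_pow] at h'
    exact lt_irrefl _ h'
  exact (v.valuation_lt_one_iff_mem (67 : ℤ)).mp hlt

/-- `592 ∉ v` when `67 ∈ v` (Bezout: `6·592 − 53·67 = 1`). [folklore] -/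
theorem not_mem_c₄_67A1 {v : HeightOneSpectrum ℤ} (hp : (67 : ℤ) ∈ v.asIdeal) :
    (592 : ℤ) ∉ v.asIdeal := by
  intro hc
  have hone : (1 : ℤ) ∈ v.asIdeal := by
    have := v.asIdeal.add_mem (v.asIdeal.mul_mem_left (-53) hp) (v.asIdeal.mul_mem_left 6 hc)
    convert this using 1
    norm_num
  exact v.isPrime.ne_top ((Ideal.eq_top_iff_one _).mpr hone)

/-- At the place above `67`, `c₄ = 592` is a `v`-unit. [cite: SilvermanAEC2009, VII.5 Prop. 5.1(b)] -/
theorem valuation_c₄_eq_one_67A1 {v : HeightOneSpectrum ℤ} (hp : (67 : ℤ) ∈ v.asIdeal) :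
    v.valuation ℚ (⟨0, 1, 1, -12, -21⟩ : WeierstrassCurve ℚ).c₄ = 1 := by
  rw [c₄_67A1]
  by_contra h
  have h' : v.valuation ℚ (algebraMap ℤ ℚ 592) ≠ 1 := by simpa using h
  have hlt := lt_of_le_of_ne (v.valuation_le_one (592 : ℤ)) h'
  exact not_mem_c₄_67A1 hp ((v.valuation_lt_one_iff_mem (592 : ℤ)).mp hlt)

/-- At the place above `67` the reduction is multiplicative (`v(c₄) = 1`, `v(Δ) < 1`). [cite: SilvermanAEC2009, VII.5 Prop. 5.1(b)] -/
theorem hasMultiplicativeReductionAt_67A1 {v : HeightOneSpectrum ℤ}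
    (h : v.valuation ℚ (⟨0, 1, 1, -12, -21⟩ : WeierstrassCurve ℚ).Δ < 1) :
    haveI := isElliptic_67A1
    (⟨0, 1, 1, -12, -21⟩ : WeierstrassCurve ℚ).HasMultiplicativeReductionAt v :=
  haveI := isElliptic_67A1
  hasMultiplicativeReductionAt_of_valuation_c₄_eq_one (isIntegralAt_67A1 v)
    (valuation_c₄_eq_one_67A1 (mem_of_valuation_Δ_lt_one_67A1 h)) h

/-- **Split multiplicative reduction at `67`.** For the place `v` above `67`, the chosen local minimal model of `67a1` has split multiplicative reduction:
the node-tangent quadratic `592 T² + 3602` of the integral model factors as `592 (T − 30)(T + 30)` over `κ(O_v)` (`592·900 + 3602 = 67·8006`), i.e.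
`a_67(67a1) = +1` (Cremona Table 1: `67A1` has `r = 0`, `w = +1 = a_67`). [cite: CremonaAlgorithms1997, Table 1 (67A1) and §2.11] -/
theorem hasSplitMultiplicativeReductionAt_67A1 {v : HeightOneSpectrum ℤ}
    (h : v.valuation ℚ (⟨0, 1, 1, -12, -21⟩ : WeierstrassCurve ℚ).Δ < 1) :
    haveI := isElliptic_67A1
    (⟨0, 1, 1, -12, -21⟩ : WeierstrassCurve ℚ).HasSplitMultiplicativeReductionAt v := by
  haveI := isElliptic_67A1
  have hp := mem_of_valuation_Δ_lt_one_67A1 h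
  have hc₄ := valuation_c₄_eq_one_67A1 hp
  have hW := isIntegralAt_67A1 v
  set O := v.adicCompletionIntegers ℚ with hO
  set K := v.adicCompletion ℚ with hK
  set EK := (⟨0, 1, 1, -12, -21⟩ : WeierstrassCurve ℚ).baseChange K with hEK
  haveI hmin : EK.IsMinimal O :=
    isMinimalAt_of_lt_valuation_c₄ hW
      (by rw [hc₄, ← WithZero.exp_zero]; exact WithZero.exp_lt_exp.mpr (by norm_num))
  haveI : EK.IsElliptic := by rw [hEK, WeierstrassCurve.baseChange]; infer_instance
  obtain ⟨Dv, hD⟩ : ∃ Dv : VariableChange K, (⟨0, 1, 1, -12, -21⟩ : WeierstrassCurve ℚ).localMinimalModel v = Dv • EK := ⟨_, rfl⟩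
  have hm : EK.HasMultiplicativeReduction O :=
    (hasMultiplicativeReduction_iff_of_isMinimal_of_eq_smul O hD EK.isUnit_Δ.ne_zero).mp
      (hasMultiplicativeReductionAt_67A1 h)
  unfold WeierstrassCurve.HasSplitMultiplicativeReductionAt
  rw [hasSplitMultiplicativeReduction_iff_of_isMinimal_of_eq_smul O hD EK.isUnit_Δ.ne_zero,
    hasSplitMultiplicativeReduction_iff]
  refine ⟨hm, ?_⟩
  -- the integral model of `EK = E ⊗ K_v` has the integer coefficients of `E`
  have inj := IsFractionRing.injective O K
  have hint : ∀ z : ℤ, algebraMap O K (z : O) = (z : K) := fun z => map_intCast _ z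
  have hc4 : (EK.integralModel O).c₄ = ((592 : ℤ) : O) := inj <| by
    rw [integralModel_c₄_eq, hint, hEK, WeierstrassCurve.baseChange, map_c₄, c₄_67A1]; norm_num
  have ha1 : (EK.integralModel O).a₁ = ((0 : ℤ) : O) := inj <| by
    rw [integralModel_a₁_eq, hint, hEK, WeierstrassCurve.baseChange, map_a₁]; simp
  have ha2 : (EK.integralModel O).a₂ = ((1 : ℤ) : O) := inj <| by
    rw [integralModel_a₂_eq, hint, hEK, WeierstrassCurve.baseChange, map_a₂]; simp
  have hb2 : (EK.integralModel O).b₂ = ((4 : ℤ) : O) := inj <| by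
    rw [integralModel_b₂_eq, hint, hEK, WeierstrassCurve.baseChange, map_b₂]; norm_num [WeierstrassCurve.b₂]
  have hb4 : (EK.integralModel O).b₄ = ((-24 : ℤ) : O) := inj <| by
    rw [integralModel_b₄_eq, hint, hEK, WeierstrassCurve.baseChange, map_b₄]; norm_num [WeierstrassCurve.b₄]
  have hb6 : (EK.integralModel O).b₆ = ((-83 : ℤ) : O) := inj <| by
    rw [integralModel_b₆_eq, hint, hEK, WeierstrassCurve.baseChange, map_b₆]; norm_num [WeierstrassCurve.b₆]
  rw [hc4, ha1, ha2, hb2, hb4, hb6]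
  -- `67 = 0`, hence `536402 = 0`, in the residue field `κ(O_v)`
  set F := IsLocalRing.ResidueField O with hF
  set φ : O →+* F := algebraMap O F with hφ
  have hpF : (67 : F) = 0 := by
    have hker : (67 : ℤ) ∈ RingHom.ker ((IsLocalRing.residue O).comp (algebraMap ℤ O)) := by
      rw [ker_residue_comp_algebraMap ℚ v]; exact hp
    have h := RingHom.mem_ker.mp hker
    rwa [RingHom.comp_apply, map_ofNat, map_ofNat] at h
  have hdiff : (536402 : F[X]) = 0 := by
    rw [show (536402 : F[X]) = C (536402 : F) from (map_ofNat C 536402).symm,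
      show (536402 : F) = 67 * 8006 by norm_num, hpF, zero_mul, map_zero]
  have hsplit : (C (592 : F) * ((X - C 30) * (X + C 30))).Splits :=
    (Splits.C _).mul ((Splits.X_sub_C _).mul (Splits.X_add_C _))
  convert hsplit using 1
  simp only [Polynomial.map_sub, Polynomial.map_add, Polynomial.map_mul, Polynomial.map_pow,
    Polynomial.map_X, Polynomial.map_C]
  simp only [map_mul, map_sub, map_add, map_neg, map_ofNat, map_zero, map_one, Int.cast_ofNat, Int.cast_neg,
    Int.cast_zero, Int.cast_one]
  linear_combination hdiff

/-- **`W_v(67a1) = −1` at the place above `67`** (split multiplicative reduction). [cite: Rohrlich1993Compositio, Prop. 2(ii)] -/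
theorem localRootNumberAt_of_valuation_Δ_lt_one_67A1 {v : HeightOneSpectrum ℤ}
    (h : v.valuation ℚ (⟨0, 1, 1, -12, -21⟩ : WeierstrassCurve ℚ).Δ < 1) :
    haveI := isElliptic_67A1
    (⟨0, 1, 1, -12, -21⟩ : WeierstrassCurve ℚ).localRootNumberAt v = -1 :=
  haveI := isElliptic_67A1
  localRootNumberAt_of_hasSplitMultiplicativeReductionAt (hasSplitMultiplicativeReductionAt_67A1 h)

/-- `v(Δ) < 1` holds exactly at the place above `67`. [folklore] -/
theorem valuation_Δ_lt_one_iff_67A1 (v : HeightOneSpectrum ℤ) :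
    v.valuation ℚ (⟨0, 1, 1, -12, -21⟩ : WeierstrassCurve ℚ).Δ < 1 ↔ v = (Rat.HeightOneSpectrum.primesEquiv (R := ℤ)).symm ⟨67, by norm_num⟩ := by
  constructor
  · intro h
    have hp := mem_of_valuation_Δ_lt_one_67A1 h
    apply (Rat.HeightOneSpectrum.primesEquiv (R := ℤ)).injective
    rw [Equiv.apply_symm_apply]
    apply Subtype.ext
    have hgen := Literature.NumberTheory.EllipticCurves.Rat.natGenerator_primesEquiv_symm
      (Rat.HeightOneSpectrum.primesEquiv v)
    rw [Equiv.symm_apply_apply] at hgen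
    have hdvd : (Rat.HeightOneSpectrum.natGenerator v : ℤ) ∣ 67 := by
      rw [← Literature.NumberTheory.EllipticCurves.Rat.valuation_intCast_lt_one_iff]
      exact (v.valuation_lt_one_iff_mem (67 : ℤ)).mpr hp
    have hpr : (Rat.HeightOneSpectrum.primesEquiv v : ℕ).Prime := (Rat.HeightOneSpectrum.primesEquiv v).2
    rw [← hgen] at hpr ⊢
    have : Rat.HeightOneSpectrum.natGenerator v ∣ 67 := by exact_mod_cast hdvd
    exact (Nat.prime_dvd_prime_iff_eq hpr (by norm_num)).mp this
  · rintro rfl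
    rw [Δ_67A1, show (-67 : ℚ) = ((-67 : ℤ) : ℚ) by push_cast; ring,
      Literature.NumberTheory.EllipticCurves.Rat.valuation_intCast_lt_one_iff,
      Literature.NumberTheory.EllipticCurves.Rat.natGenerator_primesEquiv_symm]
    norm_num

/-- **The algebraic root number of `67a1` is `+1`**: `−∏ᶠ_v W_v = −W_67 = +1` (Cremona Table 1: `67A1` has rank `0`, even). [cite: CremonaAlgorithms1997, Table 1 (67A1)] -/
theorem algebraicRootNumber_67A1 :
    haveI := isElliptic_67A1
    (⟨0, 1, 1, -12, -21⟩ : WeierstrassCurve ℚ).algebraicRootNumber = 1 := by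
  haveI := isElliptic_67A1
  set v₀ : HeightOneSpectrum ℤ := (Rat.HeightOneSpectrum.primesEquiv (R := ℤ)).symm ⟨67, by norm_num⟩ with hv₀
  have h0 : (⟨0, 1, 1, -12, -21⟩ : WeierstrassCurve ℚ).localRootNumberAt v₀ = -1 :=
    localRootNumberAt_of_valuation_Δ_lt_one_67A1 ((valuation_Δ_lt_one_iff_67A1 v₀).mpr hv₀)
  have ha : ∀ v : HeightOneSpectrum ℤ, v ≠ v₀ → (⟨0, 1, 1, -12, -21⟩ : WeierstrassCurve ℚ).localRootNumberAt v = 1 := by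
    intro v hv
    refine localRootNumberAt_of_valuation_Δ_eq_one_67A1 v ?_
    rcases (WeierstrassCurve.valuation_Δ_le_one_of_isIntegralAt (isIntegralAt_67A1 v)).lt_or_eq with h | h
    · exact absurd ((valuation_Δ_lt_one_iff_67A1 v).mp h) (by rwa [hv₀] at hv)
    · exact h
  rw [WeierstrassCurve.algebraicRootNumber, finprod_eq_single _ v₀ ha, h0]
  norm_num

end LocalRootNumbers67A1

/-! ## §3 Semistability, `w(67a1) = +1` from modularity, and `r_an(67a1) = 0` -/
section RootNumber67A1

/-- **`67a1` is semistable**: good or multiplicative reduction at every finite place. [cite: SilvermanAEC2009, VII.5 Prop. 5.1] -/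
theorem isSemistable_67A1 : (⟨0, 1, 1, -12, -21⟩ : WeierstrassCurve ℚ).IsSemistable ℤ := by
  haveI := isElliptic_67A1
  intro v
  have hint := isIntegralAt_67A1 v
  rcases (WeierstrassCurve.valuation_Δ_le_one_of_isIntegralAt hint).eq_or_lt with h | h
  · exact WeierstrassCurve.isSemistableAt_of_valuation_Δ_eq_one hint h
  · exact WeierstrassCurve.isSemistableAt_of_valuation_c₄_eq_one hint (valuation_c₄_eq_one_67A1 (mem_of_valuation_Δ_lt_one_67A1 h))

/-- No place of additive reduction. [cite: SilvermanAEC2009, VII.5 Prop. 5.1] -/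
theorem not_hasAdditiveReductionAt_67A1 (v : HeightOneSpectrum ℤ) :
    haveI := isElliptic_67A1
    ¬ (⟨0, 1, 1, -12, -21⟩ : WeierstrassCurve ℚ).HasAdditiveReductionAt v :=
  haveI := isElliptic_67A1
  (WeierstrassCurve.isSemistableAt_iff_not_hasAdditiveReductionAt v _).mp (isSemistable_67A1 v)

/-- The conductor of `67a1` is squarefree (semistable). [cite: Silverman1994, IV.10.2] -/
theorem squarefree_conductorNorm_67A1 :
    haveI := isElliptic_67A1
    Squarefree ((⟨0, 1, 1, -12, -21⟩ : WeierstrassCurve ℚ).conductorNorm ℤ) :=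
  haveI := isElliptic_67A1
  (WeierstrassCurve.isSemistable_iff_squarefree_conductorNorm _).mp isSemistable_67A1

/-- **The (analytic) root number of `67a1` is `+1`, from the Modularity Theorem alone** (tree `rootNumber_eq_algebraicRootNumber_of_squarefree`, Atkin–Lehner).
[cite: CremonaAlgorithms1997, Table 1 (67A1)] [cite: BCDTJAMS2001, Thm. A] -/
theorem rootNumber_67A1 (hmod : exists_isNewformOf) :
    haveI := isElliptic_67A1
    (⟨0, 1, 1, -12, -21⟩ : WeierstrassCurve ℚ).rootNumber = 1 := by
  haveI := isElliptic_67A1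
  rw [(WeierstrassCurve.rootNumber_eq_algebraicRootNumber_of_squarefree _ squarefree_conductorNorm_67A1 hmod)
    (fun v h => (not_hasAdditiveReductionAt_67A1 v h).elim), algebraicRootNumber_67A1]

/-- ★ **`ord_{s=1} L(67a1, s) = 0` modulo PRINT**: even by parity (`w = +1`, Modularity: tree `even_analyticRank_iff_rootNumber_eq_one_of_exists_isNewformOf`) and `≤ 1` by
Kriz–Li Thm 4.3 at `d = 1` with the Table-2 (★)-datum (`krizLi_analyticRank_le_one`, over any `K` with `d_K = −7`, supplied by the caller) — Cremona's `r = 0` for `67A1`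
as a theorem; discharges the displayed `hr` of `…KrizLiAnchor67a1.lean`. [cite: CremonaAlgorithms1997, Table 1 (67A1: r = 0)] [cite: KrizLi2019, Thm. 4.3 and §6 Table 2 (row 67a1)] -/
theorem analyticRank_67A1 (h33 : KrizLi2019.thm33_rank_twist) (htab : KrizLi2019.table2_row67a1) (hmod : exists_isNewformOf)
    (K : Type) [Field K] [NumberField K] (hK : IsImaginaryQuadratic K) (hdK : NumberField.discr K = -7) :
    haveI := isElliptic_67A1
    (⟨0, 1, 1, -12, -21⟩ : WeierstrassCurve ℚ).analyticRank = 0 := by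
  haveI := isElliptic_67A1; haveI := isGloballyMinimal_67A1
  obtain ⟨_, Dt, H, ι, P, j, -, hP, hstar⟩ := htab K hK hdK
  have hle := krizLi_analyticRank_le_one _ h33 twoTorsion_67A1 K hK (satisfiesHeegnerHypothesis_67A1 hK.1 hdK) Dt H ι P hP j hstar
  have heven : Even (⟨0, 1, 1, -12, -21⟩ : WeierstrassCurve ℚ).analyticRank :=
    (even_analyticRank_iff_rootNumber_eq_one_of_exists_isNewformOf (⟨0, 1, 1, -12, -21⟩ : WeierstrassCurve ℚ) hmod).mpr (rootNumber_67A1 hmod)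
  obtain ⟨m, hm⟩ := heven
  omega

end RootNumber67A1

/-! ## §4 The U₂ sorting of the `67a1` packet with `r_an(67a1) = 0` DISCHARGED (modularity instead of the displayed `hr`) -/
section Sorting67A1

/-- ★ **THE RANK-ONE COMPANIONS `67a1^{(−7d)}` — U₂-CLASS CURVES SETTLED BY PRINT + MODULARITY ALONE**: at every global minimal `W₂ ≅ 67a1^{(−7d)}` (`d ∈ 𝒩(67a1, K)`,
`χ_d(−67) = 1`): `r_an(W₂) = 1 ∧ ¬CM ∧ BSD(W₂, 2)`; no displayed rank, no wall row, no LINE 23 stub, no GZK.  BSD is not proved by any of this; U₂ is not proved.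
[cite: KrizLi2019, Thm. 5.1 (2), Thm. 4.3, §6 Table 2 (row 67a1), Example 6.5] [cite: CreutzMiller2012, Thm. 1.1] [cite: CremonaAlgorithms1997, Table 1 (67A1)] -/
theorem printFamily67A1_krizLi_rankOneCompanions_of_modularity (hKL : KrizLi2019.thm112_bsdTwo_twist) (h33 : KrizLi2019.thm33_rank_twist)
    (htab : KrizLi2019.table2_row67a1) (hS31 : bsdTriple_of_analyticRank_le_one_of_conductor_lt) (hmod : exists_isNewformOf)
    (K : Type) [Field K] [NumberField K] (hK : IsImaginaryQuadratic K) (hdK : NumberField.discr K = -7)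
    {d : ℤ} (hd : haveI := isGloballyMinimal_67A1; KrizLi2019.InN (⟨0, 1, 1, -12, -21⟩ : WeierstrassCurve ℚ) K d)
    (hsign : haveI := isElliptic_67A1; Int.sign d * jacobiSym ((⟨0, 1, 1, -12, -21⟩ : WeierstrassCurve ℚ).conductorNorm ℤ) d.natAbs = 1)
    (W₂ : WeierstrassCurve ℚ) [W₂.IsElliptic] [W₂.IsGloballyMinimal]
    (hW₂ : ∃ C : VariableChange ℚ, C • (⟨0, 1, 1, -12, -21⟩ : WeierstrassCurve ℚ).quadraticTwist ((-7 * d : ℤ) : ℚ) = W₂) :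
    W₂.analyticRank = 1 ∧ ¬ W₂.HasCM ∧ BSDp W₂ 2 :=
  printFamily67A1_krizLi_rankOneCompanions hKL h33 htab hS31 (analyticRank_67A1 h33 htab hmod K hK hdK) K hK hdK hd hsign W₂ hW₂

/-- **THE RANK-ZERO MEMBERS `67a1^{(d)}`**, print + modularity alone: `r_an(W₁) = 0 ∧ ¬CM ∧ BSD(W₁, 2)`.  BSD is not proved by any of this.
[cite: KrizLi2019, Thm. 5.1 (2), Thm. 4.3, §6 Table 2 (row 67a1)] [cite: CreutzMiller2012, Thm. 1.1] -/
theorem printFamily67A1_krizLi_rankZeroMembers_of_modularity (hKL : KrizLi2019.thm112_bsdTwo_twist) (h33 : KrizLi2019.thm33_rank_twist)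
    (htab : KrizLi2019.table2_row67a1) (hS31 : bsdTriple_of_analyticRank_le_one_of_conductor_lt) (hmod : exists_isNewformOf)
    (K : Type) [Field K] [NumberField K] (hK : IsImaginaryQuadratic K) (hdK : NumberField.discr K = -7)
    {d : ℤ} (hd : haveI := isGloballyMinimal_67A1; KrizLi2019.InN (⟨0, 1, 1, -12, -21⟩ : WeierstrassCurve ℚ) K d)
    (hsign : haveI := isElliptic_67A1; Int.sign d * jacobiSym ((⟨0, 1, 1, -12, -21⟩ : WeierstrassCurve ℚ).conductorNorm ℤ) d.natAbs = 1)
    (W₁ : WeierstrassCurve ℚ) [W₁.IsElliptic] [W₁.IsGloballyMinimal]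
    (hW₁ : ∃ C : VariableChange ℚ, C • (⟨0, 1, 1, -12, -21⟩ : WeierstrassCurve ℚ).quadraticTwist (d : ℚ) = W₁) :
    W₁.analyticRank = 0 ∧ ¬ W₁.HasCM ∧ BSDp W₁ 2 :=
  printFamily67A1_krizLi_rankZeroMembers hKL h33 htab hS31 (analyticRank_67A1 h33 htab hmod K hK hdK) K hK hdK hd hsign W₁ hW₁

/-- **THE PARTNER `67a1^{(−7)}` (`N = 3283`)**, print + modularity alone: `r_an(W₀) = 1 ∧ ¬CM ∧ BSD(W₀, 2)`.  BSD is not proved by any of this.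
[cite: KrizLi2019, Thm. 4.3, §6 Table 2 (row 67a1)] [cite: CreutzMiller2012, Thm. 1.1] -/
theorem printFamily67A1_krizLi_partner_of_modularity (h33 : KrizLi2019.thm33_rank_twist) (htab : KrizLi2019.table2_row67a1)
    (hS31 : bsdTriple_of_analyticRank_le_one_of_conductor_lt) (hmod : exists_isNewformOf)
    (K : Type) [Field K] [NumberField K] (hK : IsImaginaryQuadratic K) (hdK : NumberField.discr K = -7)
    (W₀ : WeierstrassCurve ℚ) [W₀.IsElliptic] [W₀.IsGloballyMinimal]
    (hW₀ : ∃ C : VariableChange ℚ, C • (⟨0, 1, 1, -12, -21⟩ : WeierstrassCurve ℚ).quadraticTwist ((-7 : ℤ) : ℚ) = W₀) :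
    W₀.analyticRank = 1 ∧ ¬ W₀.HasCM ∧ BSDp W₀ 2 :=
  printFamily67A1_krizLi_partner h33 htab hS31 (analyticRank_67A1 h33 htab hmod K hK hdK) K hK hdK W₀ hW₀

/-- **The rank-one witness member `67a1^{(-203)}`**, print + modularity alone. BSD is not proved by any of this. [cite: KrizLi2019, Thm. 5.1 (2), Thm. 4.3, §6 Table 2 (row 67a1)] -/
theorem printFamily67A1_krizLi_witnessneg203_of_modularity (hKL : KrizLi2019.thm112_bsdTwo_twist) (h33 : KrizLi2019.thm33_rank_twist)
    (htab : KrizLi2019.table2_row67a1) (hS31 : bsdTriple_of_analyticRank_le_one_of_conductor_lt) (hmod : exists_isNewformOf)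
    (K : Type) [Field K] [NumberField K] (hK : IsImaginaryQuadratic K) (hdK : NumberField.discr K = -7)
    (W₂ : WeierstrassCurve ℚ) [W₂.IsElliptic] [W₂.IsGloballyMinimal]
    (hW₂ : ∃ C : VariableChange ℚ, C • (⟨0, 1, 1, -12, -21⟩ : WeierstrassCurve ℚ).quadraticTwist ((-203 : ℤ) : ℚ) = W₂) :
    W₂.analyticRank = 1 ∧ ¬ W₂.HasCM ∧ BSDp W₂ 2 :=
  printFamily67A1_krizLi_witnessneg203 hKL h33 htab hS31 (analyticRank_67A1 h33 htab hmod K hK hdK) K hK hdK W₂ hW₂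

end Sorting67A1

end Summit.BirchSwinnertonDyer.BirchSwinnertonDyer.Theorems.GenusExact.TwinSwap.KrizLiAnchor67a1

end
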